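import Summits.ValiantsHypothesis.ValiantsHypothesis.Theorems.SymPencilPerFourCrossPairNoJoint
import Summits.ValiantsHypothesis.ValiantsHypothesis.Theorems.SymPencilPerFourIsotropicComplement

/-!
# Route `SymPencil` — no JOINT family of FIVE squares on a singular subspace containing the
# cross pair `E₁₀ + E₀₂`, `E₂₀ + E₀₁` (`--supports` stmt-ValiantsHypothesis-5674 `SdcSuperquadratic`; V-side brick for
# ROW `r = 11` of the size-`28` table (cell `(11,5,5)`); rung currency only)

The size-`27` brick `…CrossPairNoJoint.not_jointFamily_four_of_cross_pair` kills joint families of FOUR squares on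
every `V` containing the cross pair `E₁₀ + E₀₂`, `E₂₀ + E₀₁`; its last step inverts the `4 × 4` matrix
`𝔅 = (β_k(U_i, y(t)))`.  At size `28` the kernel family has FIVE squares and `𝔅` is `4 × 5`.
**Theorem** (`not_jointFamily_five_of_cross_pair`): the same statement with `c : Fin 5 → K`,
`β : Fin 5 → …`.  PROOF = the four-square proof VERBATIM (same line `y(t)`, same `Q_t`, same test
vectors with Gram `½ J`, same radical vector `z(t)`) except the matrix step, which now uses that
`z(t)` is also `Q_t`-ISOTROPIC: the weighted vector `(β_k(z(t), y(t)))_k` is orthogonal to the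
non-degenerate `4`-frame `(β_k(U_i, y(t)))_k` in five weighted squares and isotropic, hence killed by
the weights (`…IsotropicComplement.eq_zero_of_orth_rows_isotropic`).

Honest framing: a brick towards «no 5-dimensional singular `W` carries a joint family of FIVE
squares» (row `r = 11` of the size-`28` table, OPEN); nothing about the determinantal complexity of
`per_4` is claimed; stmt-5674 `SdcSuperquadratic` OPEN; `VP ≠ VNP` not moved.  No definitions, no
named facts. [folklore]
-/

noncomputable section

-- single-conjunct layout: Sub = Summit, duplicated namespace component intended
set_option linter.dupNamespace false

namespace Summit.ValiantsHypothesis.ValiantsHypothesis.Theorems.SymPencilPerFourCrossPairNoJointFive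

open MvPolynomial Module Matrix
open Literature.Computability.AlgebraicComplexity
open Summit.ValiantsHypothesis.ValiantsHypothesis.Theorems.SymPencilBoxFourEquality
open Summit.ValiantsHypothesis.ValiantsHypothesis.Theorems.SymPencilPerFourCrossPairNoJoint
open Summit.ValiantsHypothesis.ValiantsHypothesis.Theorems.SymPencilPerFourIsotropicComplement

variable {K : Type*} [Field K]

/-- **No joint family of FIVE squares on a subspace containing `E₁₀ + E₀₂` and `E₂₀ + E₀₁`.**
See the module docstring. [folklore] -/
theorem not_jointFamily_five_of_cross_pair [CharZero K] (V : Submodule K (Fin 4 × Fin 4 → K))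
    (h₀ : (fun p : Fin 4 × Fin 4 => if p = (1, 0) then (1 : K) else if p = (0, 2) then 1 else 0) ∈ V)
    (h₁ : (fun p : Fin 4 × Fin 4 => if p = (2, 0) then (1 : K) else if p = (0, 1) then 1 else 0) ∈ V)
    (c : Fin 5 → K) (β : Fin 5 → ((Fin 4 × Fin 4 → K) →ₗ[K] (Fin 4 × Fin 4 → K) →ₗ[K] K)) :
    ¬ (∀ u : Fin 4 × Fin 4 → K, ∀ y ∈ V, ∃ e₀ e₁ : K, ∀ s : K,
        eval (u + s • y) (perPoly (Fin 4) K) = e₀ + s * e₁ + s ^ 2 * ∑ k, c k * (β k u y) ^ 2) := by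
  classical
  intro hj
  have hcases : ∀ i : Fin 4, i = 0 ∨ i = 1 ∨ i = 2 ∨ i = 3 := by decide
  -- the two generators and the line `y(t) = y₀ + t y₁`
  set y₀ : Fin 4 × Fin 4 → K :=
    fun p => if p = (1, 0) then (1 : K) else if p = (0, 2) then 1 else 0 with hy₀
  set y₁ : Fin 4 × Fin 4 → K :=
    fun p => if p = (2, 0) then (1 : K) else if p = (0, 1) then 1 else 0 with hy₁
  have hyV : ∀ t : K, y₀ + t • y₁ ∈ V := fun t => V.add_mem h₀ (V.smul_mem t h₁)
  -- Fin 4 literal facts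
  obtain ⟨f01, f02, f03, f10, f12, f13, f20, f21, f23, f30, f31, f32⟩ :
      (((0 : Fin 4) = 1) = False) ∧ (((0 : Fin 4) = 2) = False) ∧ (((0 : Fin 4) = 3) = False) ∧
      (((1 : Fin 4) = 0) = False) ∧ (((1 : Fin 4) = 2) = False) ∧ (((1 : Fin 4) = 3) = False) ∧
      (((2 : Fin 4) = 0) = False) ∧ (((2 : Fin 4) = 1) = False) ∧ (((2 : Fin 4) = 3) = False) ∧
      (((3 : Fin 4) = 0) = False) ∧ (((3 : Fin 4) = 1) = False) ∧ (((3 : Fin 4) = 2) = False) := by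
    refine ⟨?_, ?_, ?_, ?_, ?_, ?_, ?_, ?_, ?_, ?_, ?_, ?_⟩ <;> decide
  -- `succAbove` on `Fin 4` (rows / columns `0, 1, 2` only are needed)
  obtain ⟨e00, e01, e02, e10, e11, e12, e20, e21, e22⟩ :
      (0 : Fin 4).succAbove 0 = 1 ∧ (0 : Fin 4).succAbove 1 = 2 ∧ (0 : Fin 4).succAbove 2 = 3 ∧
      (1 : Fin 4).succAbove 0 = 0 ∧ (1 : Fin 4).succAbove 1 = 2 ∧ (1 : Fin 4).succAbove 2 = 3 ∧
      (2 : Fin 4).succAbove 0 = 0 ∧ (2 : Fin 4).succAbove 1 = 1 ∧ (2 : Fin 4).succAbove 2 = 3 := by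
    decide
  -- (A) the `s²`-coefficient `Q t u` along the line (an opaque name with its defining equation)
  obtain ⟨Q, hQ⟩ : ∃ Q : K → (Fin 4 × Fin 4 → K) → K, ∀ t u, Q t u =
      u (3, 3) * (u (2, 1) + t * u (2, 2) + t * u (1, 1) + t ^ 2 * u (1, 2)) +
        (u (2, 3) + t * u (1, 3)) * (u (3, 1) + t * u (3, 2)) := ⟨_, fun _ _ => rfl⟩
  have hA : ∀ (t : K) (u : Fin 4 × Fin 4 → K) (s : K),
      eval (u + s • (y₀ + t • y₁)) (perPoly (Fin 4) K) =
        (Matrix.of fun i j => u (i, j)).permanent +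
        s * (((Matrix.of fun i j => u (i, j)).submatrix (1 : Fin 4).succAbove
              (0 : Fin 4).succAbove).permanent +
            ((Matrix.of fun i j => u (i, j)).submatrix (0 : Fin 4).succAbove
              (2 : Fin 4).succAbove).permanent +
            t * ((Matrix.of fun i j => u (i, j)).submatrix (2 : Fin 4).succAbove
              (0 : Fin 4).succAbove).permanent +
            t * ((Matrix.of fun i j => u (i, j)).submatrix (0 : Fin 4).succAbove
              (1 : Fin 4).succAbove).permanent) +
        s ^ 2 * Q t u := by
    intro t u s
    rw [eval_perPoly, Matrix.permanent_fin_four_row, Matrix.permanent_fin_four_row, hQ]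
    simp only [Matrix.permanent_fin_three_row, Matrix.of_apply, Matrix.submatrix_apply, Pi.add_apply,
      Pi.smul_apply, smul_eq_mul, hy₀, hy₁, Prod.mk.injEq, e00, e01, e02, e10, e11, e12, e20, e21,
      e22, f01, f02, f10, f12, f20, f21, f30, f31, f32, and_true, and_false, if_true, if_false]
    ring
  -- (B) coefficient extraction
  have hB : ∀ (t : K) (u : Fin 4 × Fin 4 → K),
      c 0 * (β 0 u (y₀ + t • y₁)) ^ 2 + c 1 * (β 1 u (y₀ + t • y₁)) ^ 2 +
        c 2 * (β 2 u (y₀ + t • y₁)) ^ 2 + c 3 * (β 3 u (y₀ + t • y₁)) ^ 2 +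
        c 4 * (β 4 u (y₀ + t • y₁)) ^ 2 = Q t u := by
    intro t u
    obtain ⟨e₀, e₁, he⟩ := hj u _ (hyV t)
    have h := coeff_two_eq_of_forall₂ (fun s => (he s).symm.trans (hA t u s))
    simpa only [Fin.sum_univ_five] using h
  -- (C) polarisation
  have hC : ∀ (t : K) (u u' : Fin 4 × Fin 4 → K),
      c 0 * β 0 u (y₀ + t • y₁) * β 0 u' (y₀ + t • y₁) +
        c 1 * β 1 u (y₀ + t • y₁) * β 1 u' (y₀ + t • y₁) +
        c 2 * β 2 u (y₀ + t • y₁) * β 2 u' (y₀ + t • y₁) +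
        c 3 * β 3 u (y₀ + t • y₁) * β 3 u' (y₀ + t • y₁) +
        c 4 * β 4 u (y₀ + t • y₁) * β 4 u' (y₀ + t • y₁) =
      2⁻¹ * (Q t (u + u') - Q t u - Q t u') := by
    intro t u u'
    have h := hB t (u + u')
    rw [map_add (β 0), map_add (β 1), map_add (β 2), map_add (β 3), map_add (β 4)] at h
    simp only [LinearMap.add_apply] at h
    have hu := hB t u
    have hu' := hB t u'
    linear_combination (2⁻¹ : K) * (h - hu - hu')
  -- the unit vectors, the four test vectors `U = (e₃₃, e₂₁, e₂₃, e₃₁)` and the Gram matrix `J`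
  obtain ⟨E, hE⟩ : ∃ E : Fin 4 × Fin 4 → (Fin 4 × Fin 4 → K), ∀ P p, E P p = if p = P then 1 else 0 :=
    ⟨fun P p => if p = P then 1 else 0, fun _ _ => rfl⟩
  obtain ⟨U, hU0, hU1, hU2, hU3⟩ : ∃ U : Fin 4 → (Fin 4 × Fin 4 → K),
      U 0 = E (3, 3) ∧ U 1 = E (2, 1) ∧ U 2 = E (2, 3) ∧ U 3 = E (3, 1) :=
    ⟨![E (3, 3), E (2, 1), E (2, 3), E (3, 1)], rfl, rfl, rfl, rfl⟩
  obtain ⟨J, hJ⟩ : ∃ J : Matrix (Fin 4) (Fin 4) K, ∀ i j, J i j =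
      if (i = 0 ∧ j = 1) ∨ (i = 1 ∧ j = 0) ∨ (i = 2 ∧ j = 3) ∨ (i = 3 ∧ j = 2) then 1 else 0 :=
    ⟨Matrix.of fun i j =>
      if (i = 0 ∧ j = 1) ∨ (i = 1 ∧ j = 0) ∨ (i = 2 ∧ j = 3) ∨ (i = 3 ∧ j = 2) then 1 else 0,
      fun _ _ => rfl⟩
  have hJJ : J * J = 1 := by
    ext i j
    rw [Matrix.mul_apply, Fin.sum_univ_four, Matrix.one_apply]
    rcases hcases i with rfl | rfl | rfl | rfl <;> rcases hcases j with rfl | rfl | rfl | rfl <;>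
      · simp only [hJ, f01, f02, f03, f10, f12, f13, f20, f21, f23, f30, f31, f32,
          and_true, and_false, or_true, or_false, if_true, if_false]
        ring
  -- Gram values on the test vectors: `½ (Q(Uᵢ+Uⱼ) - Q Uᵢ - Q Uⱼ) = ½ Jᵢⱼ`
  have hQU : ∀ (t : K) (i j : Fin 4),
      2⁻¹ * (Q t (U i + U j) - Q t (U i) - Q t (U j)) = 2⁻¹ * J i j := by
    intro t i j
    rcases hcases i with rfl | rfl | rfl | rfl <;> rcases hcases j with rfl | rfl | rfl | rfl <;>
      · simp only [hU0, hU1, hU2, hU3, hJ, hQ, hE, Pi.add_apply, Prod.mk.injEq, f01, f02, f03, f10,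
          f12, f13, f20, f21, f23, f30, f31, f32, and_true, and_false, or_true, or_false, if_true,
          if_false]
        ring
  -- the isotropic vector `z(t) = t² e₂₁ - e₁₂` is `Q_t`-orthogonal to the test vectors
  have hQz : ∀ (t : K) (i : Fin 4),
      2⁻¹ * (Q t (U i + (t ^ 2 • E (2, 1) - E (1, 2))) - Q t (U i) -
        Q t (t ^ 2 • E (2, 1) - E (1, 2))) = 0 := by
    intro t i
    rcases hcases i with rfl | rfl | rfl | rfl <;>
      · simp only [hU0, hU1, hU2, hU3, hQ, hE, Pi.add_apply, Pi.sub_apply, Pi.smul_apply,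
          smul_eq_mul, Prod.mk.injEq, f12, f13, f21, f23, f31, f32, and_true, and_false, if_true,
          if_false]
        ring
  -- (D) at parameter `t`: the Gram matrix of the test vectors is `½ J` (invertible) and
  -- `z(t)` is `Q_t`-isotropic and `Q_t`-orthogonal to them, so `c_k β_k(z(t), y(t)) = 0` —
  -- FIVE squares: `…IsotropicComplement.eq_zero_of_orth_rows_isotropic` replaces invertibility
  have hQz0 : ∀ t : K, Q t (t ^ 2 • E (2, 1) - E (1, 2)) = 0 := by
    intro t
    rw [hQ]
    simp +decide [hE]
  have hD : ∀ (t : K) (k : Fin 5),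
      c k * β k (t ^ 2 • E (2, 1) - E (1, 2)) (y₀ + t • y₁) = 0 := by
    intro t
    refine eq_zero_of_orth_rows_isotropic (ι := Fin 5) (by simp) c
      (fun i k => β k (U i) (y₀ + t • y₁)) ((2 : K) • J) ?_
      (fun k => β k (t ^ 2 • E (2, 1) - E (1, 2)) (y₀ + t • y₁)) ?_ ?_
    · have hGram : (Matrix.of fun i j : Fin 4 =>
          ∑ k, c k * β k (U i) (y₀ + t • y₁) * β k (U j) (y₀ + t • y₁)) = (2⁻¹ : K) • J := by
        ext i j
        rw [Matrix.of_apply, Fin.sum_univ_five, hC t (U i) (U j), Matrix.smul_apply, smul_eq_mul,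
          hQU t i j]
      rw [hGram, Matrix.smul_mul, Matrix.mul_smul, smul_smul,
        inv_mul_cancel₀ (two_ne_zero : (2 : K) ≠ 0), one_smul, hJJ]
    · intro i
      rw [Fin.sum_univ_five, hC t (U i) _, hQz t i]
    · have h := hB t (t ^ 2 • E (2, 1) - E (1, 2))
      rw [hQz0 t] at h
      rw [Fin.sum_univ_five]
      linear_combination h
  -- (E) the cubic in `t`: its `t²` and `t³` coefficients vanish
  have hE2 : ∀ k : Fin 5, c k * β k (E (2, 1)) y₀ = 0 ∧ c k * β k (E (2, 1)) y₁ = 0 := by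
    intro k
    refine coeff_cubic_eq_zero (A := -(c k * β k (E (1, 2)) y₀)) (B := -(c k * β k (E (1, 2)) y₁))
      fun t => ?_
    have h := hD t k
    simp only [map_sub, map_smul, map_add, LinearMap.sub_apply, LinearMap.smul_apply,
      smul_eq_mul] at h
    linear_combination h
  -- (F) contradiction at `t = 1`
  have hF := hC 1 (E (2, 1)) (E (3, 3))
  have hJ10 : J 1 0 = 1 := by
    simp only [hJ, f10, f12, f13, f01, false_and, and_true, true_or, false_or, or_true,
      if_true]
  have hval := hQU 1 1 0
  rw [hU1, hU0, hJ10, mul_one] at hval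
  have hsplit : ∀ k : Fin 5, c k * β k (E (2, 1)) (y₀ + (1 : K) • y₁) = 0 := fun k => by
    rw [one_smul, map_add, mul_add, (hE2 k).1, (hE2 k).2, add_zero]
  have h2 : (2⁻¹ : K) = 0 := by
    rw [← hval, ← hF]
    linear_combination hsplit 0 * β 0 (E (3, 3)) (y₀ + (1 : K) • y₁) +
      hsplit 1 * β 1 (E (3, 3)) (y₀ + (1 : K) • y₁) +
      hsplit 2 * β 2 (E (3, 3)) (y₀ + (1 : K) • y₁) + hsplit 3 * β 3 (E (3, 3)) (y₀ + (1 : K) • y₁) +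
      hsplit 4 * β 4 (E (3, 3)) (y₀ + (1 : K) • y₁)
  exact (inv_ne_zero (two_ne_zero : (2 : K) ≠ 0)) h2

end Summit.ValiantsHypothesis.ValiantsHypothesis.Theorems.SymPencilPerFourCrossPairNoJointFive

end
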